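import Literature.NumberTheory.EllipticCurves.Kim2025.LargeImageStructureOPEN
import Summits.BirchSwinnertonDyer.Rank1Residual.X4.KuriharaClasswideRankOne
import HarnessLib

/-!
# X4 at `p ≥ 3` under `3`-adic tower surjectivity: the LOWER half and rank one from ONE unit Kurihara
# number, CONDITIONAL on the announced Kim 2025 (arXiv:2505.09121, PREPRINT) structure theorem
# (cell `b2b-bsdres`, team n1011, seat p09, OWNERS row T-a4; sibling of `Additive/X4SharpThreeKimLargeImage.lean`)

HONEST FRAMING (cell `b2b-bsdres`, run/shared/lean/b2b/bsd-rank1-residual/, verbatim in every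
file): the goal of the cell is to DELETE the COMBINATION-SHAPED residual classes of the
Birch–Swinnerton-Dyer formula for ALL analytic-rank `≤ 1` elliptic curves over `ℚ` — "full BSD
formula for every rank `≤ 1` curve in class `C`" assembled STRICTLY from published theorems — so
that the rank-`≤ 1` remainder becomes exactly the CONSTRUCTION-SHAPED classes, which are TYPED
(missing-input `Prop`s), NOT attempted. This is not "finishing BSD". Team n1011 (N10/N11, the X4 ∧
`p = 3` additive block) is a RESEARCH ROUTE; no claim beyond the stated classes; the label of X4 and
the §I marks are UNCHANGED by this file; nothing is booked. An ANNOUNCED preprint enters ONLY as an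
explicitly labelled OPEN hypothesis: every theorem below carrying `hKim25u`/`hKim25r : Kim2025.…_OPEN`
is CONDITIONAL on the unrefereed arXiv:2505.09121v1 (C.-H. Kim, *The refined Tamagawa number
conjectures for GL₂*, 2025; its `p = 3` Kolyvagin-system input, Sakamoto JTNB 36 (2024), IS refereed).
Theorems only (pure compositions; no definition, no named fact minted here). FLAG `Kim2025-preprint`
(referee-1 ACK-1 T-a4, proviso 3) on EVERY theorem below taking a `Kim2025.…_OPEN` binder.

## What this file proves

The sibling Literature file `Kim2025/LargeImageStructureOPEN` (p249366) types Kim 2025 Thm. 1.1 /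
Cor. 1.7 at `p ≥ 3` under LARGE image (tower surjectivity) as OPEN `Prop`s in the binder shapes of the
published `p ≥ 5` facts. Here the two certificate clauses are consumed, mirroring additive-p3's
`X4/KuriharaClasswide.lean` / `KuriharaClasswideRankOne.lean` (which do the same at `p ≥ 5` from
the PUBLISHED Kim 2026 facts):

* §3 (`p ≥ 3`, analytic rank `0`, ONE unit Kurihara number at a cyclic level `n ∈ 𝒩₁`): the EXACT
  BOUNDARY `BSD(E,p) ⟺ p ∤ ∏ c_ℓ` (`bsdp_iff_not_dvd_tamagawaProduct_of_kim2025_OPEN_rankZero`) and,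
  on X4 ∧ `r_an = 0` ∧ tower with the typed input `X4.KuriharaUnitAt W p D.f`, `BSD(E,p) ∧ MissingPPartAt W p`
  on the `p ∤ ∏ c_ℓ` rows WHATEVER `ord_p #Ш_an` is — at `p = 3` this makes every LOWER@3 row of N11
  (`9 ∣ #Ш_an`, `3 ∤ ∏ c_ℓ`) ONE certificate per pair, exactly N10's `p ≥ 5` shape; Kim–Pollack
  App. §8.1.1 lists five such additive-at-`3` curves (19215.x1, 22077.g1, 73206.r1, 83790.b1,
  84825.y1: `Ш[3^∞] ≅ (ℤ/9)²` from `δ̃_{ℓ₁ℓ₂} ≢ 0`); and the other side of the boundary (on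
  `p ∣ ∏ c_ℓ` rows the level-`𝒩₁` input FAILS granted BSD — Kim–Pollack §8.1.2, level `𝒩₂`).
* §4 (`p ≥ 3`, analytic rank `1`, a unit at a PRIME Kolyvagin level): `BSD(E,p) ⟺ ord_p #Ш_an = 0`
  and `BSD(E,p)` on the `p ∤ #Ш_an` rows — §I O7 ∩ X4@3 (10 105 surj(3) S-b pairs) per pair.

Nothing booked; marks unchanged until the referee / rmap seats rule on the reading. References: Kim
2025 [Kim2025RefinedTNC] Thm. 1.1, Thm. 1.2, Cor. 1.7, §8.1; Sakamoto 2024 [Sakamoto2024KolyvaginThree]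
Thm. 1.1; Kim 2026 [Kim2022StructureSelmer] Thm. 1.9, Conj. 1.10; Miller 2011 [Miller2011LMS] Def. 1.1.
-/

noncomputable section

open scoped Classical MatrixGroups ModularForm

open CongruenceSubgroup WeierstrassCurve Literature.NumberTheory.EllipticCurves
  Literature.NumberTheory.EllipticCurves.ModularForms
  Literature.NumberTheory.EllipticCurves.Rank1Residual
  Literature.NumberTheory.EllipticCurves.Rank1Residual.Typed

namespace Summit.BirchSwinnertonDyer.Rank1Residual.Additive

variable (W : WeierstrassCurve ℚ) [W.IsElliptic] [W.IsGloballyMinimal] (p : ℕ) [hp : Fact p.Prime]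

/-! ### §3 `p ≥ 3`, unit Kurihara number: the exact boundary and the LOWER half per pair -/

/-- **The exact boundary of the Kurihara route in analytic rank `0` at `p ≥ 3` under tower
surjectivity, ANY reduction at `p`** — CONDITIONAL on the announced unit-Kurihara-number clause
(`hKim25u`, OPEN) and Gross–Zagier–Kolyvagin: `p ≥ 3`, `ρ̄_{E,p^n}` onto ∀ `n`, `L(E,1) ≠ 0`, datum
`D` with `p ∤ c_D`, period transfer, one cyclic level `n ∈ 𝒩₁` with a unit `kuriharaNumber D.f p n ψ`
⟹ `BSD(E,p) ⟺ p ∤ ∏ c_ℓ`. The `p ≥ 5` twin from published print is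
`X4.bsdp_iff_not_dvd_tamagawaProduct_of_kim_rankZero`. [claim: Kim2025RefinedTNC, status: under-review]
[cite: Kim2025RefinedTNC, Thm. 1.1 ("BSD"), Cor. 1.7 (ANNOUNCED, OPEN binder)] [cite: Miller2011LMS, Def. 1.1] -/
theorem bsdp_iff_not_dvd_tamagawaProduct_of_kim2025_OPEN_rankZero
    (hKim25u : Kim2025.rankZero_padicValRat_sha_of_kuriharaNumber_ne_zero_of_towerSurj_OPEN)
    (hGZK : rank_eq_analyticRank_of_analyticRank_le_one) (hp3 : 3 ≤ p)
    (htower : ∀ n : ℕ, W.HasSurjectiveModNGaloisRep (p ^ n : ℕ)) (hL : W.entireLFunction 1 ≠ 0)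
    {N : ℕ} [NeZero N] (D : ModularParametrizationData W N) (hc : ¬ (p : ℤ) ∣ D.maninConstant)
    (hper : ∃ u : ℚ, ‖(u : ℚ_[p])‖ = 1 ∧ W.realPeriodRat = u * plusPeriod D.f)
    (n : ℕ) [NeZero n] (hn : Kato.IsKolyvaginProduct W p 1 n)
    (hcyc : ∀ (ℓ : ℕ) [Fact ℓ.Prime], ℓ ∣ n →
      Nat.card {P : ((WeierstrassCurve.integralModelInt W).map
          (Int.castRingHom (ZMod ℓ))).toAffine.Point // p • P = 0} ≤ p)
    (ψ : (ℓ : ℕ) → (ZMod ℓ)ˣ →* Multiplicative (ZMod (p ^ 1)))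
    (hψ : ∀ ℓ ∈ n.primeFactors, Function.Surjective (ψ ℓ))
    (hδ : kuriharaNumber D.f (p ^ 1) n ψ ≠ 0) : BSDp W p ↔ ¬ p ∣ W.tamagawaProduct := by
  have hr0 : W.analyticRank = 0 := analyticRank_eq_zero_of_entireLFunction_one_ne_zero hL
  obtain ⟨hmw, hfin⟩ := hGZK W (by rw [hr0]; exact zero_le_one)
  obtain ⟨q, hq, hval⟩ := hKim25u W p hp3 htower hL hfin D hc hper n hn hcyc ψ hψ hδ
  have hsurj : W.HasSurjectiveModNGaloisRep p := by simpa using htower 1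
  exact X4.bsdp_iff_not_dvd_tamagawaProduct_of_rankZero_witness W p hmw hfin hL
    (hasIrreducibleModPGaloisRep_of_hasSurjectiveModNGaloisRep W p hsurj) hq hval

/-- **X4 ∧ `r_an = 0` ∧ tower: `BSD(E,p) ⟺ p ∤ ∏ c_ℓ` given the typed input `X4.KuriharaUnitAt`**
(one unit Kurihara number at a cyclic level), CONDITIONAL on `hKim25u` (OPEN); modularity reads
`r_an = 0` as `L(E,1) ≠ 0`. At `p = 3` these are N11's LOWER@3 rows (`9 ∣ #Ш_an`, `3 ∤ ∏ c_ℓ`):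
Kim–Pollack App. §8.1.1 lists 19215.x1, 22077.g1, 73206.r1, 83790.b1, 84825.y1 (additive at `3`,
`Ш[3^∞] ≅ (ℤ/9)²` from `δ̃_{ℓ₁ℓ₂} ≢ 0`). Per pair; NOT a class theorem.
[claim: Kim2025RefinedTNC, status: under-review] [cite: Kim2025RefinedTNC, Thm. 1.1, Cor. 1.7, §8.1.1 (ANNOUNCED, OPEN binder)]
[cite: Miller2011LMS, Def. 1.1] -/
theorem X4RankZero.bsdp_iff_not_dvd_tamagawaProduct_of_kim2025_OPEN_of_kuriharaUnitAt
    (hKim25u : Kim2025.rankZero_padicValRat_sha_of_kuriharaNumber_ne_zero_of_towerSurj_OPEN)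
    (hGZK : rank_eq_analyticRank_of_analyticRank_le_one) (hmod : hasEntireLFunction_rat)
    (hr : W.analyticRank = 0) (hX : ClassX4 W p)
    (htower : ∀ n : ℕ, W.HasSurjectiveModNGaloisRep (p ^ n : ℕ))
    {N : ℕ} [NeZero N] (D : ModularParametrizationData W N) (hc : ¬ (p : ℤ) ∣ D.maninConstant)
    (hper : ∃ u : ℚ, ‖(u : ℚ_[p])‖ = 1 ∧ W.realPeriodRat = u * plusPeriod D.f)
    (hK : X4.KuriharaUnitAt W p D.f) : BSDp W p ↔ ¬ p ∣ W.tamagawaProduct := by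
  obtain ⟨n, hn0, hn, hcyc, ψ, hψ, hδ⟩ := hK
  exact bsdp_iff_not_dvd_tamagawaProduct_of_kim2025_OPEN_rankZero W p hKim25u hGZK
    ((by have h2 := hp.out.two_le; have hne : p ≠ 2 := hX.1; omega)) htower ((W.analyticRank_eq_zero_iff_holds (hmod W)).mp hr) D hc hper
    n hn hcyc ψ hψ hδ

/-- **LOWER@3 made certificate-shaped: `BSD(E,p)` on X4 ∧ `r_an = 0` ∧ tower ∧ `p ∤ c_D` ∧
`p ∤ ∏ c_ℓ` from ONE unit Kurihara number** (typed input `X4.KuriharaUnitAt W p D.f`), CONDITIONAL on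
`hKim25u` (OPEN) — whatever `ord_p #Ш_an` is (the `9 ∣ #Ш_an` rows of N11 included); hence also the
typed missing input `MissingPPartAt W p`. Per pair. [claim: Kim2025RefinedTNC, status: under-review]
[cite: Kim2025RefinedTNC, Thm. 1.1, Cor. 1.7 (ANNOUNCED, OPEN binder)] [cite: Miller2011LMS, Def. 1.1] -/
theorem X4RankZero.bsdp_of_kim2025_OPEN_of_kuriharaUnitAt
    (hKim25u : Kim2025.rankZero_padicValRat_sha_of_kuriharaNumber_ne_zero_of_towerSurj_OPEN)
    (hGZK : rank_eq_analyticRank_of_analyticRank_le_one) (hmod : hasEntireLFunction_rat)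
    (hr : W.analyticRank = 0) (hX : ClassX4 W p)
    (htower : ∀ n : ℕ, W.HasSurjectiveModNGaloisRep (p ^ n : ℕ))
    {N : ℕ} [NeZero N] (D : ModularParametrizationData W N) (hc : ¬ (p : ℤ) ∣ D.maninConstant)
    (hper : ∃ u : ℚ, ‖(u : ℚ_[p])‖ = 1 ∧ W.realPeriodRat = u * plusPeriod D.f)
    (htam : ¬ p ∣ W.tamagawaProduct) (hK : X4.KuriharaUnitAt W p D.f) :
    BSDp W p ∧ MissingPPartAt W p := by
  have hB : BSDp W p :=
    (X4RankZero.bsdp_iff_not_dvd_tamagawaProduct_of_kim2025_OPEN_of_kuriharaUnitAt W p hKim25u hGZK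
      hmod hr hX htower D hc hper hK).mpr htam
  haveI : Finite W.sha := (hGZK W (by rw [hr]; exact zero_le_one)).2
  exact ⟨hB, missingPPartAt_of_bsdp W p hB⟩

/-- **The other side of the boundary at `p ≥ 3`**: on X4 ∧ `r_an = 0` ∧ tower with `p ∣ ∏ c_ℓ`,
granted `BSD(E,p)` the typed input `X4.KuriharaUnitAt` FAILS (every mod-`p` Kurihara number at every
cyclic level vanishes) — the TAM-DEFECT rows need the level-`𝒩₂` numbers (Kim–Pollack App. §8.1.2,
20787.e1 at `3`). CONDITIONAL on `hKim25u` (OPEN). [claim: Kim2025RefinedTNC, status: under-review]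
[cite: Kim2025RefinedTNC, Thm. 1.1, §8.1.2 (ANNOUNCED, OPEN binder)] [cite: Miller2011LMS, Def. 1.1] -/
theorem X4RankZero.not_kuriharaUnitAt_of_kim2025_OPEN_of_bsdp_of_dvd_tamagawaProduct
    (hKim25u : Kim2025.rankZero_padicValRat_sha_of_kuriharaNumber_ne_zero_of_towerSurj_OPEN)
    (hGZK : rank_eq_analyticRank_of_analyticRank_le_one) (hmod : hasEntireLFunction_rat)
    (hr : W.analyticRank = 0) (hX : ClassX4 W p)
    (htower : ∀ n : ℕ, W.HasSurjectiveModNGaloisRep (p ^ n : ℕ))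
    {N : ℕ} [NeZero N] (D : ModularParametrizationData W N) (hc : ¬ (p : ℤ) ∣ D.maninConstant)
    (hper : ∃ u : ℚ, ‖(u : ℚ_[p])‖ = 1 ∧ W.realPeriodRat = u * plusPeriod D.f)
    (htam : p ∣ W.tamagawaProduct) (hB : BSDp W p) : ¬ X4.KuriharaUnitAt W p D.f := fun hK =>
  (X4RankZero.bsdp_iff_not_dvd_tamagawaProduct_of_kim2025_OPEN_of_kuriharaUnitAt W p hKim25u hGZK hmod
    hr hX htower D hc hper hK).mp hB htam

/-! ### §4 `p ≥ 3`, analytic rank `1`: `Ш(E/ℚ)[p^∞] = 0` from a prime-level unit (O7 ∩ X4@3) -/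

/-- **X4 ∧ `r_an = 1` ∧ tower: `BSD(E,p) ⟺ ord_p #Ш_an = 0` given the typed input
`X4.KuriharaUnitPrimeAt`** (a unit Kurihara number at a PRIME cyclic Kolyvagin level), CONDITIONAL on
the announced rank-one clause `hKim25r` (OPEN); GZK (`r_an = 1` forces `L(E,1) = 0`).
Serves §I O7's X4@3 rows (`r = 1`, 10 105 surj(3) S-b pairs) per pair. The `p ≥ 5` twin from
published print is `X4.bsdp_iff_padicValRat_eq_zero_of_kuriharaUnitPrimeAt_of_analyticRank_eq_one`.
[claim: Kim2025RefinedTNC, status: under-review] [cite: Kim2025RefinedTNC, Thm. 1.1 (Str)/("BSD") (ANNOUNCED, OPEN binder)]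
[cite: Miller2011LMS, Def. 1.1] -/
theorem X4RankOne.bsdp_iff_padicValRat_eq_zero_of_kim2025_OPEN_of_kuriharaUnitPrimeAt
    (hKim25r : Kim2025.rankOne_card_sha_eq_one_of_kuriharaNumber_ne_zero_of_towerSurj_OPEN)
    (hGZK : rank_eq_analyticRank_of_analyticRank_le_one)
    (hr : W.analyticRank = 1) (hX : ClassX4 W p)
    (htower : ∀ n : ℕ, W.HasSurjectiveModNGaloisRep (p ^ n : ℕ))
    {N : ℕ} [NeZero N] (D : ModularParametrizationData W N) (hc : ¬ (p : ℤ) ∣ D.maninConstant)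
    (hper : ∃ u : ℚ, ‖(u : ℚ_[p])‖ = 1 ∧ W.realPeriodRat = u * plusPeriod D.f)
    (hK : X4.KuriharaUnitPrimeAt W p D.f) {q : ℚ} (hq : shaAn W = (q : ℂ)) :
    BSDp W p ↔ padicValRat p q = 0 := by
  obtain ⟨ℓ, hℓF, hℓ, hcyc, ψ, hψ, hδ⟩ := hK
  obtain ⟨hmw, hfin⟩ := hGZK W (by rw [hr])
  have hL : W.entireLFunction 1 = 0 := by
    by_contra hL
    have h0 := analyticRank_eq_zero_of_entireLFunction_one_ne_zero hL
    omega
  have hcard := hKim25r W p ((by have h2 := hp.out.two_le; have hne : p ≠ 2 := hX.1; omega)) htower hL hr hfin D hc hper ℓ hℓ hcyc ψ hψ hδ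
  exact X4.bsdp_iff_padicValRat_eq_zero_of_card_primaryComponent_eq_one W p hmw hfin hcard hq

/-- **`BSD(E,p)` on X4 ∧ `r_an = 1` ∧ tower ∧ `ord_p #Ш_an = 0` from a prime-level unit Kurihara
number**, CONDITIONAL on `hKim25r` (OPEN). Per pair. [claim: Kim2025RefinedTNC, status: under-review]
[cite: Kim2025RefinedTNC, Thm. 1.1 (ANNOUNCED, OPEN binder)] [cite: Miller2011LMS, Def. 1.1] -/
theorem X4RankOne.bsdp_of_kim2025_OPEN_of_kuriharaUnitPrimeAt
    (hKim25r : Kim2025.rankOne_card_sha_eq_one_of_kuriharaNumber_ne_zero_of_towerSurj_OPEN)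
    (hGZK : rank_eq_analyticRank_of_analyticRank_le_one)
    (hr : W.analyticRank = 1) (hX : ClassX4 W p)
    (htower : ∀ n : ℕ, W.HasSurjectiveModNGaloisRep (p ^ n : ℕ))
    {N : ℕ} [NeZero N] (D : ModularParametrizationData W N) (hc : ¬ (p : ℤ) ∣ D.maninConstant)
    (hper : ∃ u : ℚ, ‖(u : ℚ_[p])‖ = 1 ∧ W.realPeriodRat = u * plusPeriod D.f)
    (hK : X4.KuriharaUnitPrimeAt W p D.f) {q : ℚ} (hq : shaAn W = (q : ℂ)) (hv : padicValRat p q = 0) :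
    BSDp W p :=
  (X4RankOne.bsdp_iff_padicValRat_eq_zero_of_kim2025_OPEN_of_kuriharaUnitPrimeAt W p hKim25r hGZK
    hr hX htower D hc hper hK hq).mpr hv

end Summit.BirchSwinnertonDyer.Rank1Residual.Additive

end
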